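/-
Origin: expansion seat `planner-pub-hodgecm-pv07-g4-0`, handover #3 2026-08-18T11:47:05Z (`HOME/pub-hodgecm-pv07-g4/lean/Pv07g4/GenuineSchrodingerEnd.lean`, md5 0d7c2a69, 161 lines);
landed by the gen-8 packager in gate run 29 as `HodgeCM/PerL34/GenuineSchrodingerEnd.lean` (import ^import Pv07g4\.GenuineSchrodingerShift[ \t]*$→import HodgeCM.PerL34.GenuineSchrodingerShift ×1).
-/
/-
Copyright (c) 2026. All rights reserved.
Released under Apache 2.0 license as described in the file LICENSE.

# `HodgeCM/PerL34/GenuineSchrodingerEnd.lean` — the S3 END theorem with its torus side DISCHARGED by the genuine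
# split Schrödinger model (DAG-node prover #07 gen 4, unit `pub-hodgecm-pv07-g4`, file #3, RUN 29)

WIP module name `Pv07g4.GenuineSchrodingerEnd`; lands as `HodgeCM.PerL34.GenuineSchrodingerEnd`.
Imports pv07-g4 #2 `GenuineSchrodingerShift` only (WIP `Pv07g4.GenuineSchrodingerShift`; ONE import rewrite at intake).

## What this file proves (no placeholders, no new axioms, no cited facts)

`exists_compactDomain_thetaLift_ne_zero_genuine_shift`: pv09-g5's S3 END theorem
`exists_compactDomain_thetaLift_ne_zero_genuine_of_input` with `Sp := L²(X)` (pv13-g4's model space),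
`φ := φ_e = 1_{e(S,χ) + ∏𝒪_v³}` (#2 `phiE (shiftFor S χ hχT' hlocχ)`), `T := S`, and its SEVENTEEN torus-side binders
— the input structure `X : GenuineThetaInput …` (sixteen fields) and `hφ`, `hloc`, `hK`, `hM` — SUPPLIED BY THE KERNEL
(#2 `torusSideShift`), for every finite `S ⊇ T' ∪ {∞}` and every `χ` with level `T'`.  What remains as input is exactly
the theta / doubling side: the doubling datum `D` (with `D.ω` THE representation of the model: hypothesis
`hω : D.ω = rep L (twistChar L χ)`), the theta side `GU`, `j`, `hj`, `hχΓ`, `hχVΓ`, the glue print inputs `P`, and the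
bookkeeping `hS`; `exists_compactDomain_thetaLift_ne_zero_genuine_shift_level` removes even the bookkeeping by taking
`S := levelPlaces L T' = T' ∪ {infinite places}`.  This is the by-name CONSUMPTION check of #1/#2: the binder shapes
produced there are literally the END's.

ABSOLUTE RULE respected: nothing cited; every hypothesis of the theorem below is either data, a hypothesis of the
END theorem itself passed through unchanged, or the equation `hω` identifying the END's representation with the model's.
-/
import Summits.HodgeConjecture.HodgeCM.PerL34.GenuineSchrodingerShift_2

/-! PORT of `HodgeCM/PerL34/GenuineSchrodingerEnd.lean` (HodgeCMPerL run 82) — verbatim mechanical port; provenance in the PORT header line. -/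

set_option linter.style.longFile 0
set_option linter.unusedSectionVars false
set_option linter.unusedVariables false

noncomputable section

open MeasureTheory MeasureTheory.Measure Set Metric Function Complex ComplexConjugate Topology Filter
open scoped RestrictedProduct InnerProductSpace NNReal ENNReal Pointwise

namespace HodgeCM.PerL34.PureTensor

open HodgeCM.PerL34.SplitShells HodgeCM.PerL34.AdelicFactorisation HodgeCM.PerL34.RestrictedMeasure
open HodgeCM.PerL34.NoSmallSubgroups HodgeCM.PerL34.EulerFactorisation HodgeCM.PerL34.DiscreteFD
open HodgeCM.PerL34.LocalFactors HodgeCM.PerL34.LocalFactors.DilationModel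
open HodgeCM.PerL34.LocalModulus HodgeCM.PerL34.SplitPlaceDilation
open HodgeCM.PerL34.RallisIP HodgeCM.PerL34.Doubling HodgeCM.PerL34.N31d NumberField IsDedekindDomain
open HodgeCM.PerL34.IdelePlaces HodgeCM.PerL34.RestrictedRegroup HodgeCM.PerL34.RestrictedCutout
open HodgeCM.PerL34.IdelicTorusModel HodgeCM.PerL34.IdelicTorusModel.Genuine

attribute [local instance] LocalFactors.DilationModel.Adic.nontriviallyNormedField
  LocalFactors.DilationModel.Adic.properSpace

namespace SchrodingerModel

namespace Coeff

variable (L : Type) [Field L] [NumberField L] [IsCMField L]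

local notation3 "L⁺" => maximalRealSubfield L

set_option synthInstance.maxHeartbeats 200000 in
-- (as in the END theorem: the `SMul Γ (Model L)` instance behind `IsFundamentalDomain` is slow to find)
/-- **S3 END with the torus side discharged by the shifted, twisted genuine split Schrödinger model.**
For a CM field `L`, a finite set `S` of places of `L⁺` containing the infinite places, a character `χ` of the model
group with level `T' ⊆ S`, and ANY doubling datum `D` on `Sp = L²(X)` whose representation `D.ω` IS the model
representation `rep L (twistChar L χ)` (+ the END's theta-side data and print inputs, unchanged): the END's conclusion
for the vector `φ_e = phiE (shiftFor S χ hχT' hlocχ)`, with NO representation-side hypothesis left. -/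
theorem exists_compactDomain_thetaLift_ne_zero_genuine_shift [DecidableEq (Place L⁺)]
    [∀ v : HeightOneSpectrum (𝓞 L⁺), MeasurableSpace (v.adicCompletion L⁺)]
    [∀ v : HeightOneSpectrum (𝓞 L⁺), BorelSpace (v.adicCompletion L⁺)]
    (S₀ : Finset (Place L⁺))
    {W : Type} [AddCommGroup W] [Module L W]
    {H Sbox : Type} [Group H] [AddCommGroup Sbox] [Module ℂ Sbox]
    {h : W →ₗ⋆[L] W →ₗ[L] L} (hW : IsLine L W) (hh : Anisotropic h)
    (D : DoublingDatum (Model L) H (Lp ℂ 2 (μ L)) Sbox) (GU : ThetaSide (Lp ℂ 2 (μ L)) Sbox)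
    (j : isomBox h →* H) (hj : ∀ d : unitary L, j ⟨iotaSnd d, iotaSnd_mem h d⟩ = D.ι (1, unitaryToModel L d))
    (χ : Model L →* Circle) (hχΓ : ∀ d : unitary L, χ (unitaryToModel L d) = 1)
    (hχVΓ : ∀ d : unitary L, D.χV (unitaryToModel L d) = 1)
    {hP : ∀ Ψ : Sbox, ∀ p ∈ (stabDelta L W).subgroupOf (isomBox h), ∀ x : H, D.fSW Ψ (j p * x) = D.fSW Ψ x}
    (P : GluePrintInputs D GU h j hP)
    {T' : Finset (Place L⁺)} (hχT' : RestrictedProduct.boxSubgroup (genLevel L) T' ≤ χ.ker)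
    (hlocχ : ∀ i ∈ T', Continuous fun g : locTorus L⁺ L i => χ (RestrictedProduct.mulSingle (genLevel L) i g))
    {S : Finset (Place L⁺)} (hT'S : T' ⊆ S) (hS : ∀ v : InfinitePlace L⁺, Sum.inl v ∈ S)
    (hω : D.ω = rep L (twistChar L χ)) [IsFiniteMeasure GU.μ] :
    ∃ 𝓕 : Set (Model L), IsCompact 𝓕 ∧ (interior 𝓕).Nonempty ∧ MeasurableSet 𝓕 ∧
      IsFundamentalDomain (unitaryToModel L).range 𝓕
        (haarDatum (genLevel L) (isCompact_genLevel L) (isOpen_genLevel L) S₀).μ ∧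
      (haarDatum (genLevel L) (isCompact_genLevel L) (isOpen_genLevel L) S₀).μ 𝓕 ≠ 0 ∧
      (haarDatum (genLevel L) (isCompact_genLevel L) (isOpen_genLevel L) S₀).μ 𝓕 ≠ ⊤ ∧
      ∀ [IsFiniteMeasure (((haarDatum (genLevel L) (isCompact_genLevel L) (isOpen_genLevel L) S₀).μ).restrict 𝓕)]
        (hk : Measurable (Function.uncurry (thetaFn D GU (phiE (shiftFor S χ hχT' hlocχ))))) {Ck : ℝ} (hCk : 0 ≤ Ck)
        (hkC : ∀ q u, ‖thetaFn D GU (phiE (shiftFor S χ hχT' hlocχ)) q u‖ ≤ Ck),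
        PeterssonFubini.theta GU.μ
          (((haarDatum (genLevel L) (isCompact_genLevel L) (isOpen_genLevel L) S₀).μ).restrict 𝓕) hk
          (measurable_coe_char (genLevel L) (isOpen_genLevel L) χ hχT' hlocχ) hCk hkC (norm_coe_char_le χ) ≠ 0 := by
  obtain ⟨⟨X⟩, hφ, hloc, hK, hM⟩ := torusSideShift S χ hχT' hlocχ hT'S
  have hloc' : ∀ (i : Place L⁺) (v : Lp ℂ 2 (μ L)),
      Continuous fun g : locTorus L⁺ L i => D.ω (RestrictedProduct.mulSingle (genLevel L) i g) v := by
    rw [hω]; exact hloc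
  have hK' : ∀ k ∈ RestrictedProduct.boxSubgroup (genLevel L) S,
      D.ω k (phiE (shiftFor S χ hχT' hlocχ)) = phiE (shiftFor S χ hχT' hlocχ) := by
    rw [hω]; exact hK
  have hM' : ∀ S' : Finset (Place L⁺), S ⊆ S' → ∀ y : (i : ↥S') → locTorus L⁺ L i,
      inner ℂ (phiE (shiftFor S χ hχT' hlocχ)) (D.ω (extendOne (genLevel L) S' y) (phiE (shiftFor S χ hχT' hlocχ))) =
        ∏ i : ↥S', localCoeff (genLevel L) D.ω (phiE (shiftFor S χ hχT' hlocχ)) i (y i) := by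
    rw [hω]; exact hM
  have X' : GenuineThetaInput L S (Lp ℂ 2 (μ L)) D.ω (phiE (shiftFor S χ hχT' hlocχ)) χ := by
    rw [hω]; exact X
  exact exists_compactDomain_thetaLift_ne_zero_genuine_of_input L S₀ hW hh D GU j hj χ hχΓ hχVΓ P
    (phiE (shiftFor S χ hχT' hlocχ)) hφ hloc' hχT' hlocχ hK' hM' subset_rfl hT'S hS X'

/-- the canonical finite set of places attached to a level `T'`: `T'` together with all infinite places -/
def levelPlaces [DecidableEq (Place L⁺)] (T' : Finset (Place L⁺)) : Finset (Place L⁺) :=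
  T' ∪ (Finset.univ : Finset (InfinitePlace L⁺)).image Sum.inl

/-- (Ported verbatim from the HodgeCMPerL package; no docstring in the source.) -/
theorem subset_levelPlaces [DecidableEq (Place L⁺)] (T' : Finset (Place L⁺)) : T' ⊆ levelPlaces L T' :=
  Finset.subset_union_left

/-- (Ported verbatim from the HodgeCMPerL package; no docstring in the source.) -/
theorem inl_mem_levelPlaces [DecidableEq (Place L⁺)] (T' : Finset (Place L⁺)) (v : InfinitePlace L⁺) :
    (Sum.inl v : Place L⁺) ∈ levelPlaces L T' :=
  Finset.mem_union_right _ (Finset.mem_image_of_mem _ (Finset.mem_univ v))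

set_option synthInstance.maxHeartbeats 200000 in
/-- **The same with the bookkeeping removed**: `S := levelPlaces L T' = T' ∪ {infinite places}`.  Binders = the END's
theta/doubling side, the level-`T'` character `χ` (`hχT'`, `hlocχ`, `hχΓ`) and `hω`; nothing on the representation side. -/
theorem exists_compactDomain_thetaLift_ne_zero_genuine_shift_level [DecidableEq (Place L⁺)]
    [∀ v : HeightOneSpectrum (𝓞 L⁺), MeasurableSpace (v.adicCompletion L⁺)]
    [∀ v : HeightOneSpectrum (𝓞 L⁺), BorelSpace (v.adicCompletion L⁺)]
    (S₀ : Finset (Place L⁺))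
    {W : Type} [AddCommGroup W] [Module L W]
    {H Sbox : Type} [Group H] [AddCommGroup Sbox] [Module ℂ Sbox]
    {h : W →ₗ⋆[L] W →ₗ[L] L} (hW : IsLine L W) (hh : Anisotropic h)
    (D : DoublingDatum (Model L) H (Lp ℂ 2 (μ L)) Sbox) (GU : ThetaSide (Lp ℂ 2 (μ L)) Sbox)
    (j : isomBox h →* H) (hj : ∀ d : unitary L, j ⟨iotaSnd d, iotaSnd_mem h d⟩ = D.ι (1, unitaryToModel L d))
    (χ : Model L →* Circle) (hχΓ : ∀ d : unitary L, χ (unitaryToModel L d) = 1)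
    (hχVΓ : ∀ d : unitary L, D.χV (unitaryToModel L d) = 1)
    {hP : ∀ Ψ : Sbox, ∀ p ∈ (stabDelta L W).subgroupOf (isomBox h), ∀ x : H, D.fSW Ψ (j p * x) = D.fSW Ψ x}
    (P : GluePrintInputs D GU h j hP)
    {T' : Finset (Place L⁺)} (hχT' : RestrictedProduct.boxSubgroup (genLevel L) T' ≤ χ.ker)
    (hlocχ : ∀ i ∈ T', Continuous fun g : locTorus L⁺ L i => χ (RestrictedProduct.mulSingle (genLevel L) i g))
    (hω : D.ω = rep L (twistChar L χ)) [IsFiniteMeasure GU.μ] :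
    ∃ 𝓕 : Set (Model L), IsCompact 𝓕 ∧ (interior 𝓕).Nonempty ∧ MeasurableSet 𝓕 ∧
      IsFundamentalDomain (unitaryToModel L).range 𝓕
        (haarDatum (genLevel L) (isCompact_genLevel L) (isOpen_genLevel L) S₀).μ ∧
      (haarDatum (genLevel L) (isCompact_genLevel L) (isOpen_genLevel L) S₀).μ 𝓕 ≠ 0 ∧
      (haarDatum (genLevel L) (isCompact_genLevel L) (isOpen_genLevel L) S₀).μ 𝓕 ≠ ⊤ ∧
      ∀ [IsFiniteMeasure (((haarDatum (genLevel L) (isCompact_genLevel L) (isOpen_genLevel L) S₀).μ).restrict 𝓕)]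
        (hk : Measurable (Function.uncurry (thetaFn D GU (phiE (shiftFor (levelPlaces L T') χ hχT' hlocχ)))))
        {Ck : ℝ} (hCk : 0 ≤ Ck)
        (hkC : ∀ q u, ‖thetaFn D GU (phiE (shiftFor (levelPlaces L T') χ hχT' hlocχ)) q u‖ ≤ Ck),
        PeterssonFubini.theta GU.μ
          (((haarDatum (genLevel L) (isCompact_genLevel L) (isOpen_genLevel L) S₀).μ).restrict 𝓕) hk
          (measurable_coe_char (genLevel L) (isOpen_genLevel L) χ hχT' hlocχ) hCk hkC (norm_coe_char_le χ) ≠ 0 :=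
  exists_compactDomain_thetaLift_ne_zero_genuine_shift L S₀ hW hh D GU j hj χ hχΓ hχVΓ P hχT' hlocχ
    (subset_levelPlaces L T') (inl_mem_levelPlaces L T') hω

end Coeff

end SchrodingerModel

end HodgeCM.PerL34.PureTensor

end
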